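import Summits.AtomisticToContinuum.HydrodynamicLimit.Theorems.EnskogAdjointDualityAdjointEnskogTestFamilyRPsiOneWeights
import Summits.AtomisticToContinuum.HydrodynamicLimit.Theorems.EnskogAdjointDualityAdjointEnskogTestFamilyRPsiOneTorus
import HarnessLib

/-!
# K2R refutation, identity (I), `ψ`-part — assembly (registered stub `stub_psiOne`, file 3 of 3)

Route `EnskogAdjointDuality` of `AtomisticToContinuum/HydrodynamicLimit`, crux K2R `AdjointEnskogTestFamilyR`
(stmt-AtomisticToContinuum-11592), line `refutation`.  At a constant background the defect inequality is tested
against `Z = z sin(2πx₀)` (`DZ` contributes `A₁ = −(z' sin + 2πz v₀ cos)`) and the dipole weight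
`Θ₁^R = th_R(v) v₀`, `th_R(v) = √(|v|²)(1+|v|²)⁻⁴e^{-|v|²/R}`.  For `ψ = α + β·v + γ|v|²/2` (`‖(α,β,γ)‖ ≤ C`) and
the closed-form transfer operator `Lψ = λ ∫ Y₀ρ₀ (⟪β(x⁺)−β(x),ω⟫P₂(v·ω) + (γ(x⁺)−γ(x))/2·P₃(v·ω)) dσ`:
product integrability of `Θ₁(A₁ψ + z sin·Lψ)` on `𝕋³ × ℝ³` and
`|∫∫ Θ₁(A₁ψ + z sin·Lψ) + z[(2π²/3) + (π/10)λY₀ρ₀ s_ε] J'_R Γ_c| ≤ (|z|+|z'|)(500 + 1800λY₀ρ₀)C` — transport of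
`γ|v|²/2` (`∫ th v₀²|v|² = (2π/3)J'_R`), transfer after Fubini, rotation to the pole, Haar shift and
`∫ν₀(cos−1) = 0` (`q₃ = (π/5)J'_R + O(1)`), the rest bounded by the moments `∫|v|ᵏ th_R ≤ 20`.
Preparatory files: `…RPsiOneWeights`, `…RPsiOneTorus`.  Reference: C. Cercignani, R. Illner, M. Pulvirenti,
*The Mathematical Theory of Dilute Gases* (1994), §3.1 [CIP1994].
-/

noncomputable section

open MeasureTheory Set Filter Function Metric
open scoped InnerProductSpace Real

namespace Summit.AtomisticToContinuum.HydrodynamicLimit.Theorems.EnskogAdjointDuality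

open Literature.MathematicalPhysics.KineticTheory Literature.Analysis.FluidPDE Literature.Analysis.FunctionSpaces

/-! ## The velocity slice of the operator part -/

/-- **Velocity slice of the operator part** at fixed `x`: `th_R v₀ · br` is integrable on `ℝ³ × S²` and, after
Fubini and the rotation to the pole, `∫_v ∫_σ th_R v₀ br = q₂ Φ_β(x) + (q₃/2) Φ_γ(x)`. [cite: CIP1994, §3.1] -/
theorem k2r_ref_p1_op_slice {R : ℝ} (hR : 1 ≤ R) {th : V3 → ℝ}
    (hth : ∀ v, th v = Real.sqrt (‖v‖ ^ 2) * ((1 + ‖v‖ ^ 2) ^ 4)⁻¹ * Real.exp (-‖v‖ ^ 2 / R))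
    {P2 P3 : ℝ → ℝ} (c2 : Continuous P2) (c3 : Continuous P3)
    (hP2 : ∀ a, 0 ≤ P2 a ∧ P2 a ≤ 1 + a ^ 2) (hP3 : ∀ a, |P3 a - max a 0 ^ 3| ≤ 3 * (1 + |a|))
    {C ε : ℝ} {cc : T3 → ℝ × V3 × ℝ} (hcc : Continuous cc) (hbd : ∀ x, ‖cc x‖ ≤ C)
    {br : T3 → V3 → sphere (0 : V3) 1 → ℝ}
    (hbr : ∀ x v ω, br x v ω = ⟪(cc (x + Torus.proj (ε • (ω : V3)))).2.1 - (cc x).2.1, (ω : V3)⟫_ℝ *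
        P2 ⟪v, (ω : V3)⟫_ℝ + ((cc (x + Torus.proj (ε • (ω : V3)))).2.2 - (cc x).2.2) / 2 * P3 ⟪v, (ω : V3)⟫_ℝ)
    (x : T3) :
    Integrable (fun q : V3 × sphere (0 : V3) 1 => th q.1 * q.1 0 * br x q.1 q.2)
      ((volume : Measure V3).prod (sphereMeasure : Measure (sphere (0 : V3) 1))) ∧
    (∫ v : V3, ∫ ω : sphere (0 : V3) 1, th v * v 0 * br x v ω ∂sphereMeasure) =
      (∫ v : V3, th v * v 0 * P2 (v 0)) * (∫ ω : sphere (0 : V3) 1, (ω : V3) 0 *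
          ⟪(cc (x + Torus.proj (ε • (ω : V3)))).2.1 - (cc x).2.1, (ω : V3)⟫_ℝ ∂sphereMeasure) +
        (∫ v : V3, th v * v 0 * P3 (v 0)) / 2 * (∫ ω : sphere (0 : V3) 1, (ω : V3) 0 *
          ((cc (x + Torus.proj (ε • (ω : V3)))).2.2 - (cc x).2.2) ∂sphereMeasure) := by
  haveI := isFiniteMeasure_sphereMeasure (E := V3)
  obtain ⟨hthc, hth0, -, -, -, i8⟩ := k2r_ref_p1_th_facts hR hth
  obtain ⟨hbc, hble⟩ := k2r_ref_p1_br_facts c2 c3 hP2 hP3 hcc hbd hbr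
  have hp := Torus.continuous_proj (d := Fin 3)
  -- integrability on `ℝ³ × S²`
  have hcont : Continuous fun q : V3 × sphere (0 : V3) 1 => th q.1 * q.1 0 * br x q.1 q.2 := by
    have h1 : Continuous fun q : V3 × sphere (0 : V3) 1 => br x q.1 q.2 := by
      have e : (fun q : V3 × sphere (0 : V3) 1 => br x q.1 q.2) =
          fun q => ⟪(cc (x + Torus.proj (ε • (q.2 : V3)))).2.1 - (cc x).2.1, (q.2 : V3)⟫_ℝ *
            P2 ⟪q.1, (q.2 : V3)⟫_ℝ +
            ((cc (x + Torus.proj (ε • (q.2 : V3)))).2.2 - (cc x).2.2) / 2 * P3 ⟪q.1, (q.2 : V3)⟫_ℝ :=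
        funext fun q => hbr _ _ _
      rw [e]
      fun_prop
    fun_prop
  have hle : ∀ q : V3 × sphere (0 : V3) 1, ‖th q.1 * q.1 0 * br x q.1 q.2‖ ≤
      9 * C * (th q.1 * |q.1 0| * (1 + ‖q.1‖ ^ 2) ^ 4) := fun q => by
    have hthv := hth0 q.1
    rw [Real.norm_eq_abs, abs_mul, abs_mul, abs_of_nonneg hthv]
    calc th q.1 * |q.1 0| * |br x q.1 q.2| ≤ th q.1 * |q.1 0| * (9 * C * (1 + ‖q.1‖ ^ 2) ^ 4) :=
          mul_le_mul_of_nonneg_left (hble x q.1 q.2) (mul_nonneg hthv (abs_nonneg _))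
      _ = _ := by ring
  have hint : Integrable (fun q : V3 × sphere (0 : V3) 1 => th q.1 * q.1 0 * br x q.1 q.2)
      ((volume : Measure V3).prod (sphereMeasure : Measure (sphere (0 : V3) 1))) :=
    ((i8.comp_fst _).const_mul (9 * C)).mono' hcont.aestronglyMeasurable (Eventually.of_forall hle)
  refine ⟨hint, ?_⟩
  -- Fubini and the rotation to the pole
  have hinner : ∀ ω : sphere (0 : V3) 1, ∫ v : V3, th v * v 0 * br x v ω =
      (∫ v : V3, th v * v 0 * P2 (v 0)) *
          ((ω : V3) 0 * ⟪(cc (x + Torus.proj (ε • (ω : V3)))).2.1 - (cc x).2.1, (ω : V3)⟫_ℝ) +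
        (∫ v : V3, th v * v 0 * P3 (v 0)) / 2 *
          ((ω : V3) 0 * ((cc (x + Torus.proj (ε • (ω : V3)))).2.2 - (cc x).2.2)) := fun ω => by
    obtain ⟨i2, i3, r2, r3⟩ := k2r_ref_p1_rotation hR hth c2 c3 hP2 hP3 ω
    have e : ∀ v : V3, th v * v 0 * br x v ω =
        ⟪(cc (x + Torus.proj (ε • (ω : V3)))).2.1 - (cc x).2.1, (ω : V3)⟫_ℝ * (th v * v 0 * P2 ⟪v, (ω : V3)⟫_ℝ) +
          ((cc (x + Torus.proj (ε • (ω : V3)))).2.2 - (cc x).2.2) / 2 * (th v * v 0 * P3 ⟪v, (ω : V3)⟫_ℝ) :=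
      fun v => by rw [hbr]; ring
    simp_rw [e]
    rw [integral_add (i2.const_mul _) (i3.const_mul _), integral_const_mul, integral_const_mul, r2, r3]
    ring
  have hI1 : Integrable (fun ω : sphere (0 : V3) 1 =>
      (ω : V3) 0 * ⟪(cc (x + Torus.proj (ε • (ω : V3)))).2.1 - (cc x).2.1, (ω : V3)⟫_ℝ) sphereMeasure :=
    ClampedCorrectorBirth.integrable_sphere_of_continuous' (by fun_prop)
  have hI2 : Integrable (fun ω : sphere (0 : V3) 1 =>
      (ω : V3) 0 * ((cc (x + Torus.proj (ε • (ω : V3)))).2.2 - (cc x).2.2)) sphereMeasure :=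
    ClampedCorrectorBirth.integrable_sphere_of_continuous' (by fun_prop)
  rw [integral_integral_swap (f := fun v ω => th v * v 0 * br x v ω) hint]
  simp_rw [hinner]
  rw [integral_add (hI1.const_mul _) (hI2.const_mul _), integral_const_mul, integral_const_mul]

/-! ## The assembly -/

/-- **Identity (I), `ψ`-part, with the closed-form operator** `Lψ = λ∫Y₀ρ₀·br dσ` and `‖cc‖ ≤ C`: product
integrability of `Θ₁(A₁ψ + B₁Lψ)` and `|∫∫Θ₁(A₁ψ + B₁Lψ) + z[(2π²/3) + (π/10)λY₀ρ₀s_ε]J'_RΓ_c| ≤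
(|z|+|z'|)(500 + 1800λY₀ρ₀)C`. [cite: CIP1994, §3.1] -/
theorem k2r_ref_p1_main {Y₀ ρ₀ ε lam C : ℝ} (hY : 0 < Y₀) (hρ : 0 < ρ₀) (hε : 0 < ε)
    (hk : 2 * Real.pi * ε ≤ Real.pi / 2) (hlam : 0 < lam) (hC : 0 ≤ C) {R : ℝ} (hR : 1 ≤ R) {th : V3 → ℝ}
    (hth : ∀ v, th v = Real.sqrt (‖v‖ ^ 2) * ((1 + ‖v‖ ^ 2) ^ 4)⁻¹ * Real.exp (-‖v‖ ^ 2 / R))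
    {P2 P3 : ℝ → ℝ} (c2 : Continuous P2) (c3 : Continuous P3)
    (hP2 : ∀ a, 0 ≤ P2 a ∧ P2 a ≤ 1 + a ^ 2) (hP3 : ∀ a, |P3 a - max a 0 ^ 3| ≤ 3 * (1 + |a|))
    {cc : T3 → ℝ × V3 × ℝ} (hcc : Continuous cc) (hbd : ∀ x, ‖cc x‖ ≤ C)
    {br : T3 → V3 → sphere (0 : V3) 1 → ℝ}
    (hbr : ∀ x v ω, br x v ω = ⟪(cc (x + Torus.proj (ε • (ω : V3)))).2.1 - (cc x).2.1, (ω : V3)⟫_ℝ *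
        P2 ⟪v, (ω : V3)⟫_ℝ + ((cc (x + Torus.proj (ε • (ω : V3)))).2.2 - (cc x).2.2) / 2 * P3 ⟪v, (ω : V3)⟫_ℝ)
    {Lψ : T3 → V3 → ℝ} (hL : ∀ x v, Lψ x v = lam * ∫ ω : sphere (0 : V3) 1, Y₀ * ρ₀ * br x v ω ∂sphereMeasure)
    (z z' : ℝ) :
    Integrable (fun p : T3 × V3 => (th p.2 * p.2 0) *
        ((-(z' * Torus.sinCoord 0 p.1 + z * (p.2 0 * ((2 * Real.pi) * Torus.cosCoord 0 p.1)))) *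
            ((cc p.1).1 + ⟪(cc p.1).2.1, p.2⟫_ℝ + (cc p.1).2.2 * ‖p.2‖ ^ 2 / 2) +
          (z * Torus.sinCoord 0 p.1) * Lψ p.1 p.2)) (volume.prod volume) ∧
    |(∫ x : T3, ∫ v : V3, (th v * v 0) *
        ((-(z' * Torus.sinCoord 0 x + z * (v 0 * ((2 * Real.pi) * Torus.cosCoord 0 x)))) *
            ((cc x).1 + ⟪(cc x).2.1, v⟫_ℝ + (cc x).2.2 * ‖v‖ ^ 2 / 2) +
          (z * Torus.sinCoord 0 x) * Lψ x v)) -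
        (-(z * ((2 * Real.pi ^ 2 / 3) + (Real.pi / 10) * lam * (Y₀ * ρ₀) *
            (∫ ν : sphere (0 : V3) 1, (ν : V3) 0 * Real.sin (2 * Real.pi * ε * (ν : V3) 0) ∂sphereMeasure)) *
          (∫ E in Ioi (0 : ℝ), E ^ 3 * ((1 + E) ^ 4)⁻¹ * Real.exp (-E / R)) *
          (∫ x : T3, Torus.cosCoord 0 x * (cc x).2.2)))| ≤
      (|z| + |z'|) * ((500 + 1800 * lam * (Y₀ * ρ₀)) * C) := by
  haveI := isFiniteMeasure_sphereMeasure (E := V3)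
  have hYρ : 0 ≤ Y₀ * ρ₀ := by positivity
  have hs : Continuous (Torus.sinCoord (0 : Fin 3) : T3 → ℝ) := (Torus.isSmooth_sinCoord 0).continuous
  have hc : Continuous (Torus.cosCoord (0 : Fin 3) : T3 → ℝ) := (Torus.isSmooth_cosCoord 0).continuous
  have hs1 : ∀ x : T3, |Torus.sinCoord 0 x| ≤ 1 := fun x => by
    obtain ⟨r, hr⟩ := Torus.exists_coe_eq (x 0); rw [Torus.sinCoord_of_eq hr.symm]; exact Real.abs_sin_le_one _
  have hc1 : ∀ x : T3, |Torus.cosCoord 0 x| ≤ 1 := Torus.abs_cosCoord_le 0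
  have hv0 : ∀ v : V3, |v 0| ≤ ‖v‖ := fun v => by simpa using PiLp.norm_apply_le v 0
  have hα : ∀ y, |(cc y).1| ≤ C := fun y => by rw [← Real.norm_eq_abs]; exact (norm_fst_le _).trans (hbd y)
  have hβ : ∀ y, ‖(cc y).2.1‖ ≤ C := fun y => ((norm_fst_le _).trans (norm_snd_le _)).trans (hbd y)
  have hγ : ∀ y, |(cc y).2.2| ≤ C := fun y => by
    rw [← Real.norm_eq_abs]; exact ((norm_snd_le _).trans (norm_snd_le _)).trans (hbd y)
  obtain ⟨hthc, hth0, hmom, -, ⟨i7, e7⟩, i8⟩ := k2r_ref_p1_th_facts hR hth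
  obtain ⟨i1, b1⟩ := hmom 1 (by norm_num)
  obtain ⟨i2, b2⟩ := hmom 2 (by norm_num)
  obtain ⟨i3, b3⟩ := hmom 3 le_rfl
  simp only [pow_one] at i1 b1
  obtain ⟨hLc, hLabs⟩ := k2r_ref_p1_L_facts c2 c3 hP2 hP3 hYρ hlam.le hcc hbd hbr hL
  obtain ⟨ΦB, hΦB⟩ : ∃ f : T3 → ℝ, ∀ x, f x = ∫ ω : sphere (0 : V3) 1, (ω : V3) 0 *
      ⟪(cc (x + Torus.proj (ε • (ω : V3)))).2.1 - (cc x).2.1, (ω : V3)⟫_ℝ ∂sphereMeasure := ⟨_, fun _ => rfl⟩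
  obtain ⟨ΦG, hΦG⟩ : ∃ f : T3 → ℝ, ∀ x, f x = ∫ ω : sphere (0 : V3) 1, (ω : V3) 0 *
      ((cc (x + Torus.proj (ε • (ω : V3)))).2.2 - (cc x).2.2) ∂sphereMeasure := ⟨_, fun _ => rfl⟩
  obtain ⟨hΦβc, hΦγc, hΦβle⟩ := k2r_ref_p1_Phi_facts hcc hbd ε hΦB hΦG
  obtain ⟨q2, hq2⟩ : ∃ q : ℝ, q = ∫ v : V3, th v * v 0 * P2 (v 0) := ⟨_, rfl⟩
  obtain ⟨q3, hq3⟩ : ∃ q : ℝ, q = ∫ v : V3, th v * v 0 * P3 (v 0) := ⟨_, rfl⟩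
  -- scalar abbreviations
  set J' : ℝ := ∫ E in Ioi (0 : ℝ), E ^ 3 * ((1 + E) ^ 4)⁻¹ * Real.exp (-E / R) with hJ'
  set sk : ℝ := ∫ ν : sphere (0 : V3) 1, (ν : V3) 0 * Real.sin (2 * Real.pi * ε * (ν : V3) 0) ∂sphereMeasure with hsk
  set Γc : ℝ := ∫ x : T3, Torus.cosCoord 0 x * (cc x).2.2 with hΓc
  -- the three pieces of the integrand
  set I : T3 × V3 → ℝ := fun p => (th p.2 * p.2 0) *
      ((-(z' * Torus.sinCoord 0 p.1 + z * (p.2 0 * ((2 * Real.pi) * Torus.cosCoord 0 p.1)))) *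
          ((cc p.1).1 + ⟪(cc p.1).2.1, p.2⟫_ℝ + (cc p.1).2.2 * ‖p.2‖ ^ 2 / 2) +
        (z * Torus.sinCoord 0 p.1) * Lψ p.1 p.2) with hI
  set E : T3 × V3 → ℝ := fun p =>
      th p.2 * p.2 0 * (-(z' * Torus.sinCoord 0 p.1)) *
          ((cc p.1).1 + ⟪(cc p.1).2.1, p.2⟫_ℝ + (cc p.1).2.2 * ‖p.2‖ ^ 2 / 2) +
        th p.2 * p.2 0 * (-(z * (p.2 0 * (2 * Real.pi * Torus.cosCoord 0 p.1)))) *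
          ((cc p.1).1 + ⟪(cc p.1).2.1, p.2⟫_ℝ) with hE
  set M : T3 × V3 → ℝ := fun p => (-(Real.pi * z)) *
      ((Torus.cosCoord 0 p.1 * (cc p.1).2.2) * (th p.2 * p.2 0 ^ 2 * ‖p.2‖ ^ 2)) with hM
  set O : T3 × V3 → ℝ := fun p => (th p.2 * p.2 0) * ((z * Torus.sinCoord 0 p.1) * Lψ p.1 p.2) with hO
  have hsum : ∀ p, I p = E p + M p + O p := fun p => by simp only [hI, hE, hM, hO]; ring
  -- (E): continuous, dominated by an `R`-uniformly integrable function of `v`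
  set g : V3 → ℝ := fun v => (|z| + |z'|) * (8 * C) * (‖v‖ * th v + ‖v‖ ^ 2 * th v + ‖v‖ ^ 3 * th v) with hg
  have hg_int : Integrable g := ((i1.fun_add i2).fun_add i3).const_mul _
  have hg_val : ∫ v, g v ≤ (|z| + |z'|) * (8 * C) * 60 := by
    simp only [hg]
    rw [integral_const_mul, integral_add (i1.fun_add i2) i3, integral_add i1 i2]
    exact mul_le_mul_of_nonneg_left (by linarith only [b1, b2, b3]) (by positivity)
  have hE_le : ∀ p, ‖E p‖ ≤ g p.2 := fun p => by
    rw [Real.norm_eq_abs]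
    simp only [hE, hg]
    have hthv := hth0 p.2
    have htv := hv0 p.2
    have ht0 : 0 ≤ ‖p.2‖ := norm_nonneg _
    have hin : |⟪(cc p.1).2.1, p.2⟫_ℝ| ≤ C * ‖p.2‖ := (abs_real_inner_le_norm _ _).trans (mul_le_mul_of_nonneg_right (hβ p.1) ht0)
    have hγt : |(cc p.1).2.2| * ‖p.2‖ ^ 2 ≤ C * ‖p.2‖ ^ 2 := mul_le_mul_of_nonneg_right (hγ p.1) (sq_nonneg _)
    have hψ : |(cc p.1).1 + ⟪(cc p.1).2.1, p.2⟫_ℝ + (cc p.1).2.2 * ‖p.2‖ ^ 2 / 2| ≤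
        C * (1 + ‖p.2‖ + ‖p.2‖ ^ 2) := by
      refine (abs_add_le _ _).trans ((add_le_add (abs_add_le _ _) le_rfl).trans ?_)
      rw [abs_div, abs_mul, abs_two, abs_pow, abs_norm]
      linarith only [hα p.1, hin, hγt, mul_nonneg (abs_nonneg ((cc p.1).2.2)) (sq_nonneg ‖p.2‖)]
    have hψ' : |(cc p.1).1 + ⟪(cc p.1).2.1, p.2⟫_ℝ| ≤ C * (1 + ‖p.2‖) := (abs_add_le _ _).trans (by linarith only [hα p.1, hin])
    have T1 : |th p.2 * p.2 0 * (-(z' * Torus.sinCoord 0 p.1)) *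
        ((cc p.1).1 + ⟪(cc p.1).2.1, p.2⟫_ℝ + (cc p.1).2.2 * ‖p.2‖ ^ 2 / 2)| ≤
        th p.2 * ‖p.2‖ * |z'| * (C * (1 + ‖p.2‖ + ‖p.2‖ ^ 2)) := by
      rw [abs_mul, abs_mul, abs_mul, abs_neg, abs_mul, abs_of_nonneg hthv]
      refine mul_le_mul (mul_le_mul (mul_le_mul_of_nonneg_left htv hthv) ?_ (by positivity)
        (mul_nonneg hthv ht0)) hψ (abs_nonneg _) (by positivity)
      calc |z'| * |Torus.sinCoord 0 p.1| ≤ |z'| * 1 := mul_le_mul_of_nonneg_left (hs1 _) (abs_nonneg _)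
        _ = |z'| := mul_one _
    have T2 : |th p.2 * p.2 0 * (-(z * (p.2 0 * (2 * Real.pi * Torus.cosCoord 0 p.1)))) *
        ((cc p.1).1 + ⟪(cc p.1).2.1, p.2⟫_ℝ)| ≤ th p.2 * ‖p.2‖ * (|z| * (‖p.2‖ * 7)) * (C * (1 + ‖p.2‖)) := by
      rw [abs_mul, abs_mul, abs_mul, abs_neg, abs_mul, abs_mul, abs_mul, abs_of_nonneg hthv]
      refine mul_le_mul (mul_le_mul (mul_le_mul_of_nonneg_left htv hthv) ?_ (by positivity)
        (mul_nonneg hthv ht0)) hψ' (abs_nonneg _) (by positivity)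
      refine mul_le_mul_of_nonneg_left (mul_le_mul htv ?_ (by positivity) ht0) (abs_nonneg _)
      rw [abs_of_pos Real.two_pi_pos]
      linarith only [mul_nonneg Real.pi_pos.le (sub_nonneg.2 (hc1 p.1)), Real.pi_lt_d2]
    refine (abs_add_le _ _).trans ((add_le_add T1 T2).trans ?_)
    have h1 : 0 ≤ th p.2 * C * |z| * (8 * ‖p.2‖ + ‖p.2‖ ^ 2 + ‖p.2‖ ^ 3) :=
      mul_nonneg (mul_nonneg (mul_nonneg hthv hC) (abs_nonneg _)) (by positivity)
    have h2 : 0 ≤ th p.2 * C * |z'| * (‖p.2‖ + ‖p.2‖ ^ 2 + ‖p.2‖ ^ 3) :=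
      mul_nonneg (mul_nonneg (mul_nonneg hthv hC) (abs_nonneg _)) (by positivity)
    linarith only [h1, h2]
  have hE_cont : Continuous E := by simp only [hE]; fun_prop
  have hE_int : Integrable E (volume.prod volume) := (hg_int.comp_snd _).mono' hE_cont.aestronglyMeasurable (Eventually.of_forall hE_le)
  -- (M): a product
  have hM_int : Integrable M (volume.prod volume) :=
    ((Continuous.integrable_unitAddTorus (by fun_prop : Continuous fun x : T3 => Torus.cosCoord 0 x * (cc x).2.2)).mul_prod i7).const_mul _
  -- (O): continuous, dominated by `th |v₀| (1+|v|²)⁴`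
  set KO : ℝ := |z| * (lam * (4 * Real.pi * (Y₀ * ρ₀ * (9 * C)))) with hKO
  have hO_le : ∀ p, ‖O p‖ ≤ KO * (th p.2 * |p.2 0| * (1 + ‖p.2‖ ^ 2) ^ 4) := fun p => by
    rw [Real.norm_eq_abs]
    simp only [hO, hKO]
    have hthv := hth0 p.2
    rw [abs_mul, abs_mul, abs_mul, abs_mul, abs_of_nonneg hthv]
    have h1 := hLabs p.1 p.2
    have h2 : |z| * |Torus.sinCoord 0 p.1| ≤ |z| * 1 := mul_le_mul_of_nonneg_left (hs1 _) (abs_nonneg _)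
    calc th p.2 * |p.2 0| * (|z| * |Torus.sinCoord 0 p.1| * |Lψ p.1 p.2|)
        ≤ th p.2 * |p.2 0| * (|z| * 1 * (lam * (4 * Real.pi * (Y₀ * ρ₀ * (9 * C * (1 + ‖p.2‖ ^ 2) ^ 4))))) :=
          mul_le_mul_of_nonneg_left (mul_le_mul h2 h1 (abs_nonneg _) (by positivity))
            (mul_nonneg hthv (abs_nonneg _))
      _ = _ := by ring
  have hO_cont : Continuous O := by
    have h1 : Continuous fun p : T3 × V3 => th p.2 * p.2 0 := by fun_prop
    have h2 : Continuous fun p : T3 × V3 => z * Torus.sinCoord 0 p.1 := by fun_prop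
    exact h1.mul (h2.mul hLc)
  have hO_int : Integrable O (volume.prod volume) := ((i8.const_mul KO).comp_snd _).mono' hO_cont.aestronglyMeasurable (Eventually.of_forall hO_le)
  -- (i) integrability
  have hI_int : Integrable I (volume.prod volume) := ((hE_int.add hM_int).add hO_int).congr (Eventually.of_forall fun p => (hsum p).symm)
  refine ⟨hI_int, ?_⟩
  -- (ii) the values of the three pieces
  have eM : ∫ p, M p ∂((volume : Measure T3).prod (volume : Measure V3)) =
      -(Real.pi * z) * (Γc * (2 * Real.pi / 3 * J')) := by
    simp only [hM]
    rw [integral_const_mul, integral_prod_mul (fun x : T3 => Torus.cosCoord 0 x * (cc x).2.2)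
      (fun v : V3 => th v * v 0 ^ 2 * ‖v‖ ^ 2), e7]
  have eE : |∫ p, E p ∂((volume : Measure T3).prod (volume : Measure V3))| ≤ (|z| + |z'|) * (8 * C) * 60 := by
    have h := norm_integral_le_of_norm_le (hg_int.comp_snd (volume : Measure T3)) (Eventually.of_forall hE_le)
    rw [integral_fun_snd, probReal_univ, one_smul, Real.norm_eq_abs] at h
    exact h.trans hg_val
  have hOx : ∀ x : T3, ∫ v : V3, O (x, v) =
      (z * Torus.sinCoord 0 x) * (lam * (Y₀ * ρ₀)) * (q2 * ΦB x + q3 / 2 * ΦG x) := fun x => by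
    obtain ⟨-, hslice⟩ := k2r_ref_p1_op_slice hR hth c2 c3 hP2 hP3 hcc hbd hbr x
    have hpt : ∀ v : V3, O (x, v) = (z * Torus.sinCoord 0 x) * (lam * (Y₀ * ρ₀)) *
        ∫ ω : sphere (0 : V3) 1, th v * v 0 * br x v ω ∂sphereMeasure := fun v => by
      simp only [hO]
      rw [hL x v, integral_const_mul, integral_const_mul]
      ring
    rw [integral_congr_ae (Eventually.of_forall hpt), integral_const_mul, hslice, hq2, hq3, hΦB, hΦG]
  have eO : ∫ p, O p ∂((volume : Measure T3).prod (volume : Measure V3)) =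
      z * (lam * (Y₀ * ρ₀)) * (q2 * (∫ x : T3, Torus.sinCoord 0 x * ΦB x) +
        q3 / 2 * ∫ x : T3, Torus.sinCoord 0 x * ΦG x) := by
    rw [integral_prod O hO_int]
    simp_rw [hOx]
    have j1 : Integrable (fun x : T3 => Torus.sinCoord 0 x * ΦB x) := (hs.mul hΦβc).integrable_unitAddTorus
    have j2 : Integrable (fun x : T3 => Torus.sinCoord 0 x * ΦG x) := (hs.mul hΦγc).integrable_unitAddTorus
    have e : ∀ x : T3, (z * Torus.sinCoord 0 x) * (lam * (Y₀ * ρ₀)) * (q2 * ΦB x + q3 / 2 * ΦG x) =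
        z * (lam * (Y₀ * ρ₀)) * (q2 * (Torus.sinCoord 0 x * ΦB x) + q3 / 2 * (Torus.sinCoord 0 x * ΦG x)) :=
      fun x => by ring
    simp_rw [e]
    rw [integral_const_mul, integral_add (j1.const_mul _) (j2.const_mul _), integral_const_mul, integral_const_mul]
  have hSγ : ∫ x : T3, Torus.sinCoord 0 x * ΦG x = -sk * Γc := by
    rw [(funext hΦG : ΦG = _)]
    exact k2r_ref_p1_delocalised_sin (γ := fun y => (cc y).2.2) (by fun_prop) (by positivity) hk
  -- sizes of the bounded factors
  have hSβ : |∫ x : T3, Torus.sinCoord 0 x * ΦB x| ≤ 8 * Real.pi * C := by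
    have hb : ∀ x : T3, ‖Torus.sinCoord 0 x * ΦB x‖ ≤ 8 * Real.pi * C := fun x => by
      rw [Real.norm_eq_abs, abs_mul]
      calc |Torus.sinCoord 0 x| * |ΦB x| ≤ 1 * (8 * Real.pi * C) :=
            mul_le_mul (hs1 x) (hΦβle x) (abs_nonneg _) zero_le_one
        _ = _ := one_mul _
    have h := norm_integral_le_of_norm_le_const (μ := (volume : Measure T3)) (Eventually.of_forall hb)
    rwa [probReal_univ, mul_one, Real.norm_eq_abs] at h
  have hsk_le : |sk| ≤ 4 * Real.pi := by
    have hb : ∀ ν : sphere (0 : V3) 1, ‖(ν : V3) 0 * Real.sin (2 * Real.pi * ε * (ν : V3) 0)‖ ≤ 1 := fun ν => by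
      have hω : ‖(ν : V3)‖ = 1 := norm_eq_of_mem_sphere ν
      rw [Real.norm_eq_abs, abs_mul]
      calc |(ν : V3) 0| * |Real.sin (2 * Real.pi * ε * (ν : V3) 0)| ≤ 1 * 1 :=
            mul_le_mul ((hv0 (ν : V3)).trans hω.le) (Real.abs_sin_le_one _) (abs_nonneg _) zero_le_one
        _ = 1 := one_mul _
    have h := norm_integral_le_of_norm_le_const (μ := (sphereMeasure : Measure (sphere (0 : V3) 1))) (Eventually.of_forall hb)
    rwa [k2r_sphereMeasure_real_univ, Real.norm_eq_abs, one_mul] at h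
  have hΓc_le : |Γc| ≤ C := by
    have hb : ∀ x : T3, ‖Torus.cosCoord 0 x * (cc x).2.2‖ ≤ C := fun x => by
      rw [Real.norm_eq_abs, abs_mul]
      calc |Torus.cosCoord 0 x| * |(cc x).2.2| ≤ 1 * C := mul_le_mul (hc1 x) (hγ x) (abs_nonneg _) zero_le_one
        _ = C := one_mul _
    have h := norm_integral_le_of_norm_le_const (μ := (volume : Measure T3)) (Eventually.of_forall hb)
    rwa [probReal_univ, mul_one, Real.norm_eq_abs] at h
  have hq₂ : |q2| ≤ 40 := k2r_ref_p1_q2_abs_le hR hth hP2 hq2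
  have hq₃ : |q3 - Real.pi / 5 * J'| ≤ 120 := k2r_ref_p1_q3_split hR hth c3 hP3 hq3
  -- conclusion
  have e0 : (∫ x : T3, ∫ v : V3, (th v * v 0) *
      ((-(z' * Torus.sinCoord 0 x + z * (v 0 * ((2 * Real.pi) * Torus.cosCoord 0 x)))) *
          ((cc x).1 + ⟪(cc x).2.1, v⟫_ℝ + (cc x).2.2 * ‖v‖ ^ 2 / 2) +
        (z * Torus.sinCoord 0 x) * Lψ x v)) = ∫ p, I p ∂((volume : Measure T3).prod (volume : Measure V3)) :=
    (integral_prod I hI_int).symm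
  have e1 : ∫ p, I p ∂((volume : Measure T3).prod (volume : Measure V3)) =
      (∫ p, E p ∂((volume : Measure T3).prod (volume : Measure V3))) +
        (∫ p, M p ∂((volume : Measure T3).prod (volume : Measure V3))) +
        ∫ p, O p ∂((volume : Measure T3).prod (volume : Measure V3)) := by
    rw [integral_congr_ae (Eventually.of_forall hsum), integral_add (hE_int.fun_add hM_int) hO_int, integral_add hE_int hM_int]
  have key : (∫ p, I p ∂((volume : Measure T3).prod (volume : Measure V3))) -
      (-(z * ((2 * Real.pi ^ 2 / 3) + (Real.pi / 10) * lam * (Y₀ * ρ₀) * sk) * J' * Γc)) =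
      (∫ p, E p ∂((volume : Measure T3).prod (volume : Measure V3))) +
        z * (lam * (Y₀ * ρ₀)) * (q2 * (∫ x : T3, Torus.sinCoord 0 x * ΦB x) -
          (q3 - Real.pi / 5 * J') / 2 * (sk * Γc)) := by
    rw [e1, eM, eO, hSγ]; ring
  rw [e0, key]
  have hT2 : |z * (lam * (Y₀ * ρ₀)) * (q2 * (∫ x : T3, Torus.sinCoord 0 x * ΦB x) -
      (q3 - Real.pi / 5 * J') / 2 * (sk * Γc))| ≤
      |z| * (lam * (Y₀ * ρ₀)) * (40 * (8 * Real.pi * C) + 120 / 2 * (4 * Real.pi * C)) := by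
    rw [abs_mul, abs_mul, abs_of_nonneg (by positivity : (0 : ℝ) ≤ lam * (Y₀ * ρ₀))]
    refine mul_le_mul_of_nonneg_left ?_ (by positivity)
    calc |q2 * (∫ x : T3, Torus.sinCoord 0 x * ΦB x) - (q3 - Real.pi / 5 * J') / 2 * (sk * Γc)|
        ≤ |q2 * (∫ x : T3, Torus.sinCoord 0 x * ΦB x)| + |(q3 - Real.pi / 5 * J') / 2 * (sk * Γc)| :=
          abs_sub _ _
      _ = |q2| * |∫ x : T3, Torus.sinCoord 0 x * ΦB x| + |q3 - Real.pi / 5 * J'| / 2 * (|sk| * |Γc|) := by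
          rw [abs_mul, abs_mul, abs_mul, abs_div, abs_two]
      _ ≤ 40 * (8 * Real.pi * C) + 120 / 2 * (4 * Real.pi * C) :=
          add_le_add (mul_le_mul hq₂ hSβ (abs_nonneg _) (by norm_num))
            (mul_le_mul (by linarith) (mul_le_mul hsk_le hΓc_le (abs_nonneg _) (by positivity))
              (by positivity) (by norm_num))
  calc |(∫ p, E p ∂((volume : Measure T3).prod (volume : Measure V3))) +
        z * (lam * (Y₀ * ρ₀)) * (q2 * (∫ x : T3, Torus.sinCoord 0 x * ΦB x) -
          (q3 - Real.pi / 5 * J') / 2 * (sk * Γc))|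
      ≤ |∫ p, E p ∂((volume : Measure T3).prod (volume : Measure V3))| +
          |z * (lam * (Y₀ * ρ₀)) * (q2 * (∫ x : T3, Torus.sinCoord 0 x * ΦB x) -
            (q3 - Real.pi / 5 * J') / 2 * (sk * Γc))| := abs_add_le _ _
    _ ≤ (|z| + |z'|) * (8 * C) * 60 +
          |z| * (lam * (Y₀ * ρ₀)) * (40 * (8 * Real.pi * C) + 120 / 2 * (4 * Real.pi * C)) := add_le_add eE hT2
    _ ≤ (|z| + |z'|) * ((500 + 1800 * lam * (Y₀ * ρ₀)) * C) := by
        have hπ : 560 * Real.pi ≤ 1800 := by linarith only [Real.pi_lt_d2]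
        have hP : 0 ≤ lam * (Y₀ * ρ₀) * C * |z| := by positivity
        have hP' : 0 ≤ lam * (Y₀ * ρ₀) * C * |z'| := by positivity
        linarith only [mul_le_mul_of_nonneg_left hπ hP, hP', mul_nonneg hC (abs_nonneg z), mul_nonneg hC (abs_nonneg z')]

/-! ## The registered stub -/

/-- **Registered stub `stub_psiOne`** (identity (I), `ψ`-part; line `refutation` of crux K2R
`…EnskogAdjointDuality.AdjointEnskogTestFamilyR`): against `z sin(2πx₀)` / `-(z' sin + z v₀ (2π cos))` and the
dipole weight `|v|(1+|v|²)⁻⁴e^{-|v|²/R} v₀`, `ψ = α + β·v + γ|v|²/2` and `Lψ` give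
`-z [(2π²/3) + (π/10) λ Y₀ρ₀ s_ε] J'_R ∫cos(2πx₀)γ` up to `(|z|+|z'|)(500 + 1800λY₀ρ₀)C`. [cite: CIP1994, §3.1] -/
theorem stub_psiOne :
  ∀ (Y₀ ρ₀ ε lam C : ℝ), 0 < Y₀ → 0 < ρ₀ → 0 < ε → 2 * Real.pi * ε ≤ Real.pi / 2 → 0 < lam → 0 ≤ C →
  ∃ Bdd : ℝ, ∀ (cc : UnitAddTorus (Fin 3) → ℝ × EuclideanSpace ℝ (Fin 3) × ℝ) (κ : UnitAddTorus (Fin 3) → EuclideanSpace ℝ (Fin 3) → ℝ),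
    Continuous cc → Continuous (Function.uncurry κ) → (∀ x, ‖cc x‖ ≤ C) →
    (∀ x y, dist (cc x) (cc y) ≤ C * dist x y) → (∀ x v, |κ x v| ≤ C * (1 + ‖v‖ ^ 2)) →
    ∀ (Lψ : UnitAddTorus (Fin 3) → EuclideanSpace ℝ (Fin 3) → ℝ), (∀ x v, Lψ x v = lam * ∫ ω : Metric.sphere (0 : EuclideanSpace ℝ (Fin 3)) 1, (∫ w : EuclideanSpace ℝ (Fin 3),
        max (inner ℝ (v - w) (ω : EuclideanSpace ℝ (Fin 3))) 0 * Y₀ * (ρ₀ * globalMaxwellian w) *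
          (((cc x).1 + inner ℝ (cc x).2.1 (v - inner ℝ (v - w) (ω : EuclideanSpace ℝ (Fin 3)) • (ω : EuclideanSpace ℝ (Fin 3))) + (cc x).2.2 * ‖(v - inner ℝ (v - w) (ω : EuclideanSpace ℝ (Fin 3)) • (ω : EuclideanSpace ℝ (Fin 3)))‖ ^ 2 / 2) +
            ((cc (x + Torus.proj (ε • (ω : EuclideanSpace ℝ (Fin 3))))).1 + inner ℝ (cc (x + Torus.proj (ε • (ω : EuclideanSpace ℝ (Fin 3))))).2.1 (w + inner ℝ (v - w) (ω : EuclideanSpace ℝ (Fin 3)) • (ω : EuclideanSpace ℝ (Fin 3))) + (cc (x + Torus.proj (ε • (ω : EuclideanSpace ℝ (Fin 3))))).2.2 * ‖(w + inner ℝ (v - w) (ω : EuclideanSpace ℝ (Fin 3)) • (ω : EuclideanSpace ℝ (Fin 3)))‖ ^ 2 / 2) -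
            ((cc x).1 + inner ℝ (cc x).2.1 v + (cc x).2.2 * ‖v‖ ^ 2 / 2) -
            ((cc (x + Torus.proj (ε • (ω : EuclideanSpace ℝ (Fin 3))))).1 + inner ℝ (cc (x + Torus.proj (ε • (ω : EuclideanSpace ℝ (Fin 3))))).2.1 w + (cc (x + Torus.proj (ε • (ω : EuclideanSpace ℝ (Fin 3))))).2.2 * ‖w‖ ^ 2 / 2))) ∂sphereMeasure) →
    ∀ R : ℝ, 1 ≤ R → ∀ z z' : ℝ,
    Integrable (fun p : UnitAddTorus (Fin 3) × EuclideanSpace ℝ (Fin 3) => (Real.sqrt (‖p.2‖ ^ 2) * ((1 + ‖p.2‖ ^ 2) ^ 4)⁻¹ * Real.exp (-‖p.2‖ ^ 2 / R) * p.2 0) * ((-(z' * Torus.sinCoord 0 p.1 + z * (p.2 0 * ((2 * Real.pi) * Torus.cosCoord 0 p.1)))) * ((cc p.1).1 + inner ℝ (cc p.1).2.1 p.2 + (cc p.1).2.2 * ‖p.2‖ ^ 2 / 2) + (z * Torus.sinCoord 0 p.1) * Lψ p.1 p.2)) (volume.prod volume) ∧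
    |(∫ x : UnitAddTorus (Fin 3), ∫ v : EuclideanSpace ℝ (Fin 3), (Real.sqrt (‖v‖ ^ 2) * ((1 + ‖v‖ ^ 2) ^ 4)⁻¹ * Real.exp (-‖v‖ ^ 2 / R) * v 0) * ((-(z' * Torus.sinCoord 0 x + z * (v 0 * ((2 * Real.pi) * Torus.cosCoord 0 x)))) * ((cc x).1 + inner ℝ (cc x).2.1 v + (cc x).2.2 * ‖v‖ ^ 2 / 2) + (z * Torus.sinCoord 0 x) * Lψ x v)) -
        (-(z * ((2 * Real.pi ^ 2 / 3) + (Real.pi / 10) * lam * (Y₀ * ρ₀) * (∫ ν : Metric.sphere (0 : EuclideanSpace ℝ (Fin 3)) 1, (ν : EuclideanSpace ℝ (Fin 3)) 0 * Real.sin (2 * Real.pi * ε * (ν : EuclideanSpace ℝ (Fin 3)) 0) ∂sphereMeasure)) *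
          (∫ E in Set.Ioi (0 : ℝ), E ^ 3 * ((1 + E) ^ 4)⁻¹ * Real.exp (-E / R)) * (∫ x : UnitAddTorus (Fin 3), Torus.cosCoord 0 x * (cc x).2.2)))| ≤ (|z| + |z'|) * Bdd := by
  intro Y₀ ρ₀ ε lam C hY hρ hε hk hlam hC
  refine ⟨(500 + 1800 * lam * (Y₀ * ρ₀)) * C, ?_⟩
  intro cc κ hcc _ hbd _ _ Lψ hL R hR z z'
  obtain ⟨P2, P3, c2, c3, hP2, hP3, hm⟩ := k2r_ref_p1_P_facts
  have hL' : ∀ x v, Lψ x v = lam * ∫ ω : sphere (0 : V3) 1, Y₀ * ρ₀ *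
      (⟪(cc (x + Torus.proj (ε • (ω : V3)))).2.1 - (cc x).2.1, (ω : V3)⟫_ℝ * P2 ⟪v, (ω : V3)⟫_ℝ +
        ((cc (x + Torus.proj (ε • (ω : V3)))).2.2 - (cc x).2.2) / 2 * P3 ⟪v, (ω : V3)⟫_ℝ) ∂sphereMeasure :=
    fun x v => by
    rw [hL x v]
    congr 1
    refine integral_congr_ae (Eventually.of_forall fun ω => ?_)
    exact k2r_ref_psi_bracket_integral (fun ω v => (hm ω v).1) (fun ω v => (hm ω v).2.1)
      (fun ω v => (hm ω v).2.2) (cc x) (cc (x + Torus.proj (ε • (ω : V3)))) v ω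
  exact k2r_ref_p1_main hY hρ hε hk hlam hC hR (th := fun v => Real.sqrt (‖v‖ ^ 2) * ((1 + ‖v‖ ^ 2) ^ 4)⁻¹ *
    Real.exp (-‖v‖ ^ 2 / R)) (fun _ => rfl) c2 c3 hP2 hP3 hcc hbd
    (br := fun x v ω => ⟪(cc (x + Torus.proj (ε • (ω : V3)))).2.1 - (cc x).2.1, (ω : V3)⟫_ℝ * P2 ⟪v, (ω : V3)⟫_ℝ +
      ((cc (x + Torus.proj (ε • (ω : V3)))).2.2 - (cc x).2.2) / 2 * P3 ⟪v, (ω : V3)⟫_ℝ)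
    (fun _ _ _ => rfl) hL' z z'

end Summit.AtomisticToContinuum.HydrodynamicLimit.Theorems.EnskogAdjointDuality
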